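import Mathlib.RingTheory.Kaehler.TensorProduct
import HarnessLib

/-!
# Kähler differentials of a tensor product: `Ω_{P∕k} ≅ (P ⊗_R Ω_{R∕k}) ⊕ (P ⊗_S Ω_{S∕k})` for `P = R ⊗_k S`
# (Eisenbud, *Commutative Algebra*, Prop. 16.5; Liu, *Algebraic Geometry and Arithmetic Curves*, §6.1 Exercise 1.5)

For a commutative ring `k` and a PUSHOUT square of commutative rings
```
R ──→ P
↑     ↑
k ──→ S        (`Algebra.IsPushout k R S P`, e.g. `P = R ⊗[k] S`)
```
the module of Kähler differentials of `P` over `k` is the direct sum of the base changes of `Ω_{R∕k}`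
and `Ω_{S∕k}` — the "product formula" (Eisenbud, Prop. 16.5: "if `T = R ⊗_k S` then
`Ω_{T/k} ≅ (T ⊗_R Ω_{R/k}) ⊕ (T ⊗_S Ω_{S/k})`"); on generators `d(r·s) ↦ (s ⊗ dr, r ⊗ ds)`.

Everything is PROVED, from Mathlib's base change isomorphism
`KaehlerDifferential.tensorKaehlerEquiv : P ⊗[R] Ω[R⁄k] ≃ₗ[P] Ω[P⁄S]` (for the pushout square) and
the first fundamental exact sequence `P ⊗[S] Ω[S⁄k] → Ω[P⁄k] → Ω[P⁄S] → 0`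
(`KaehlerDifferential.exact_mapBaseChange_map`): the two relative-differential maps
`Ω[P⁄k] → Ω[P⁄S]`, `Ω[P⁄k] → Ω[P⁄R]` are jointly bijective because each of them, precomposed with
the OTHER base change map, is the base change isomorphism
(`map_comp_mapBaseChange_eq_tensorKaehlerEquiv`), which splits both fundamental sequences.

* `prodMap k R S P : Ω[P⁄k] →ₗ[P] Ω[P⁄S] × Ω[P⁄R]` — the pair of the two relative-differential maps,
  `prodMap_bijective`, `prodEquiv k R S P : Ω[P⁄k] ≃ₗ[P] Ω[P⁄S] × Ω[P⁄R]`;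
* **`tensorProductEquiv k R S P : Ω[P⁄k] ≃ₗ[P] (P ⊗[R] Ω[R⁄k]) × (P ⊗[S] Ω[S⁄k])`** — the
  product formula — with `tensorProductEquiv_D_algebraMap_left ∕ _right` (values on `dr`, `ds`),
  `tensorProductEquiv_symm_apply` (the inverse is `(x, y) ↦ mapBaseChange x + mapBaseChange y`),
  `tensorProductEquiv_symm_tmul_D_left ∕ _right`.

Motivation (family `hodge`, road №4, crux stmt-HodgeConjecture-26512, registered stub (c1Ω)
`Literature.AlgebraicGeometry.Motives.Mumford1970_cotangentSheaf_abelianVariety_free`): the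
affine-chart input of the product formula for the cotangent SHEAF
`Ω_{X ×_k Y ∕ k} ≅ pr₁^*Ω_{X∕k} ⊕ pr₂^*Ω_{Y∕k}` (the charts `Spec (Rᵢ ⊗_k Sⱼ)` of any product cone are
pushout squares), itself the input of the Bosch–Lütkebohmert–Raynaud argument (*Néron Models*, §4.2
Prop. 2) that `Ω¹` of a group scheme over a field is free. Stated for an abstract pushout square (not
only for `R ⊗[k] S` with Mathlib's `Algebra.TensorProduct.rightAlgebra`) so that it applies verbatim to
the section rings of affine charts.

Mathlib (pin v4.32.0) has the base change `tensorKaehlerEquiv(Base)` and the fundamental sequence but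
not the product formula (`RingTheory/Kaehler/{Basic,TensorProduct,JacobiZariski,Polynomial}` checked);
the tree had no ring-level product formula either.

Presearch (D-0064 ∕ R16.40 (ε)): «product formula for Kähler differentials of `R ⊗_k S`» →
[corpus: book:liu2006-algebraic-geometry-arithmetic-curves chunk p0270] Liu, §6.1 Exercise 1.5 («Let `X`, `Y`
be `S`-schemes … Show that `Ω¹_{X ×_S Y} ≃ p^*Ω¹_{X/S} ⊕ q^*Ω¹_{Y/S}`» — the sheaf form, whose affine case is
this file) and [corpus: paper:arxiv-2205.08117 p. 12] citing «[Eisenbud 1995], Proposition 16.5» for exactly the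
direct sum decomposition `Ω_{R₀ ⊗_k R'} = (Ω_{R₀} ⊗ …) ⊕ (Ω_{R'} ⊗ …)`; galaxy: no relevant hit; no prior
formalisation found.

## References

* D. Eisenbud, *Commutative Algebra with a View Toward Algebraic Geometry*, GTM 150, Springer (1995),
  doi:10.1007/978-1-4612-5350-1, §16.1, Prop. 16.5. [Eisenbud1995]
* Q. Liu, *Algebraic Geometry and Arithmetic Curves*, Oxford GTM 6 (2002), §6.1, Exercise 1.5
  (sheaf form). [Liu2002]
* A. Grothendieck, J. Dieudonné, EGA IV, Première partie (Publ. Math. IHÉS 20, 1964), Chap. 0,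
  §20.5 (base change and tensor products of differentials). [EGA0IV]
-/

open TensorProduct

namespace Literature.Algebra.Derivations

namespace KaehlerDifferential

open _root_.KaehlerDifferential

variable (k R S P : Type*) [CommRing k] [CommRing R] [CommRing S] [CommRing P]
  [Algebra k R] [Algebra k S] [Algebra k P] [Algebra R P] [Algebra S P]
  [IsScalarTower k R P] [IsScalarTower k S P]

/-- In a triangle `k → R → P`: the relative-differential map `Ω[P⁄k] → Ω[P⁄R]` kills the image of the
base change map `P ⊗[R] Ω[R⁄k] → Ω[P⁄k]` (`p ⊗ dr ↦ p·dr ↦ 0`): the composite in the first fundamental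
sequence of `k → R → P` is zero (Mathlib `KaehlerDifferential.exact_mapBaseChange_map`). [cite: Eisenbud1995, Prop. 16.5] -/
theorem map_mapBaseChange_self (y : P ⊗[R] Ω[R⁄k]) :
    map k R P P (mapBaseChange k R P y) = 0 :=
  (exact_mapBaseChange_map k R P).apply_apply_eq_zero y

/-- In a PUSHOUT square `P = R ⊗_k S`: the relative-differential map `Ω[P⁄k] → Ω[P⁄R]` restricted
along the base change map `P ⊗[S] Ω[S⁄k] → Ω[P⁄k]` IS Mathlib's base change isomorphism
`P ⊗[S] Ω[S⁄k] ≅ Ω[P⁄R]` (`p ⊗ ds ↦ p · d_{P/R}(s)`) — the splitting of the first fundamental sequence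
of `k → S → P`. [cite: Eisenbud1995, Prop. 16.5] -/
theorem map_comp_mapBaseChange_eq_tensorKaehlerEquiv [Algebra.IsPushout k R S P] :
    (map k R P P).comp (mapBaseChange k S P) = (tensorKaehlerEquiv k R S P).toLinearMap := by
  apply TensorProduct.AlgebraTensorModule.ext
  intro p x
  obtain ⟨x, rfl⟩ := tensorProductTo_surjective _ _ x
  induction x with
  | zero => simp only [map_zero, TensorProduct.tmul_zero]
  | add x y ex ey => simp only [map_add, TensorProduct.tmul_add, ex, ey]
  | tmul s t =>
    simp only [Derivation.tensorProductTo_tmul, LinearMap.coe_comp, Function.comp_apply,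
      LinearEquiv.coe_coe]
    rw [← smul_tmul, mapBaseChange_tmul, map_smul, map_D, map_D, tensorKaehlerEquiv_tmul_D,
      Algebra.algebraMap_self, RingHom.id_apply]

/-- Pointwise form of `map_comp_mapBaseChange_eq_tensorKaehlerEquiv`. [cite: Eisenbud1995, Prop. 16.5] -/
theorem map_mapBaseChange_right [Algebra.IsPushout k R S P] (x : P ⊗[S] Ω[S⁄k]) :
    map k R P P (mapBaseChange k S P x) = tensorKaehlerEquiv k R S P x :=
  LinearMap.congr_fun (map_comp_mapBaseChange_eq_tensorKaehlerEquiv k R S P) x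

/-- The pair of the two relative-differential maps `Ω[P⁄k] → Ω[P⁄S] × Ω[P⁄R]`,
`ω ↦ (ω mod im(P ⊗ Ω[S⁄k]), ω mod im(P ⊗ Ω[R⁄k]))`. [cite: Eisenbud1995, Prop. 16.5] -/
noncomputable def prodMap : Ω[P⁄k] →ₗ[P] Ω[P⁄S] × Ω[P⁄R] :=
  (map k S P P).prod (map k R P P)

/-- Components of `prodMap`. [cite: Eisenbud1995, Prop. 16.5] -/
@[simp]
theorem prodMap_apply (ω : Ω[P⁄k]) : prodMap k R S P ω = (map k S P P ω, map k R P P ω) := rfl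

variable [Algebra.IsPushout k R S P]

/-- `prodMap (mapBaseChange_S x) = (0, e_R x)`: on the image of `P ⊗[S] Ω[S⁄k]` the first component
vanishes and the second is the base change isomorphism. [cite: Eisenbud1995, Prop. 16.5] -/
theorem prodMap_mapBaseChange_right (x : P ⊗[S] Ω[S⁄k]) :
    prodMap k R S P (mapBaseChange k S P x) = (0, tensorKaehlerEquiv k R S P x) := by
  rw [prodMap_apply, map_mapBaseChange_self, map_mapBaseChange_right]

/-- `prodMap (mapBaseChange_R y) = (e_S y, 0)`. [cite: Eisenbud1995, Prop. 16.5] -/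
theorem prodMap_mapBaseChange_left (y : P ⊗[R] Ω[R⁄k]) :
    prodMap k R S P (mapBaseChange k R P y) =
      (haveI : Algebra.IsPushout k S R P := Algebra.IsPushout.symm inferInstance; tensorKaehlerEquiv k S R P y, 0) := by
  haveI : Algebra.IsPushout k S R P := Algebra.IsPushout.symm inferInstance
  rw [prodMap_apply, map_mapBaseChange_self, map_mapBaseChange_right]

/-- **The two relative-differential maps are jointly bijective** `Ω[P⁄k] ≅ Ω[P⁄S] × Ω[P⁄R]` for a
pushout square `P = R ⊗_k S` (Eisenbud, Prop. 16.5, in relative-differential form). Injective: a form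
killed by `Ω[P⁄k] → Ω[P⁄S]` comes from `P ⊗[S] Ω[S⁄k]` (exactness), on which `Ω[P⁄k] → Ω[P⁄R]` is the
base change isomorphism; surjective: `(a, b)` is hit by `mapBaseChange (e_S⁻¹ a) + mapBaseChange (e_R⁻¹ b)`.
[cite: Eisenbud1995, Prop. 16.5] -/
theorem prodMap_bijective : Function.Bijective (prodMap k R S P) := by
  haveI : Algebra.IsPushout k S R P := Algebra.IsPushout.symm inferInstance
  constructor
  · rw [← LinearMap.ker_eq_bot, Submodule.eq_bot_iff]
    intro ω hω
    rw [LinearMap.mem_ker, prodMap_apply, Prod.mk_eq_zero] at hω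
    obtain ⟨x, rfl⟩ := ((exact_mapBaseChange_map k S P) ω).mp hω.1
    rw [map_mapBaseChange_right k R S P x] at hω
    rw [(tensorKaehlerEquiv k R S P).map_eq_zero_iff.mp hω.2, map_zero]
  · rintro ⟨a, b⟩
    refine ⟨mapBaseChange k R P ((tensorKaehlerEquiv k S R P).symm a) +
      mapBaseChange k S P ((tensorKaehlerEquiv k R S P).symm b), ?_⟩
    rw [map_add, prodMap_mapBaseChange_left, prodMap_mapBaseChange_right, LinearEquiv.apply_symm_apply,
      LinearEquiv.apply_symm_apply, Prod.mk_add_mk, add_zero, zero_add]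

/-- `Ω[P⁄k] ≃ₗ[P] Ω[P⁄S] × Ω[P⁄R]` for a pushout square `P = R ⊗_k S`: the two relative-differential
maps (Eisenbud, Prop. 16.5, in relative-differential form). [cite: Eisenbud1995, Prop. 16.5] -/
noncomputable def prodEquiv : Ω[P⁄k] ≃ₗ[P] Ω[P⁄S] × Ω[P⁄R] :=
  LinearEquiv.ofBijective (prodMap k R S P) (prodMap_bijective k R S P)

/-- Components of `prodEquiv`. [cite: Eisenbud1995, Prop. 16.5] -/
@[simp]
theorem prodEquiv_apply (ω : Ω[P⁄k]) : prodEquiv k R S P ω = (map k S P P ω, map k R P P ω) := rfl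

/-- **Product formula for Kähler differentials** (Eisenbud, *Commutative Algebra*, Prop. 16.5: "if
`T = R ⊗_k S` then `Ω_{T/k} ≅ (T ⊗_R Ω_{R/k}) ⊕ (T ⊗_S Ω_{S/k})`"; Liu §6.1 Exercise 1.5 is the sheaf
form): for a pushout square `P = R ⊗_k S` of commutative rings,
`Ω[P⁄k] ≃ₗ[P] (P ⊗[R] Ω[R⁄k]) × (P ⊗[S] Ω[S⁄k])`, `d(r·s) ↦ (s ⊗ dr, r ⊗ ds)`. The composite of
`prodEquiv` with the inverses of Mathlib's base change isomorphisms
`tensorKaehlerEquiv : P ⊗[R] Ω[R⁄k] ≅ Ω[P⁄S]`, `P ⊗[S] Ω[S⁄k] ≅ Ω[P⁄R]`. [cite: Eisenbud1995, Prop. 16.5] -/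
noncomputable def tensorProductEquiv : Ω[P⁄k] ≃ₗ[P] (P ⊗[R] Ω[R⁄k]) × (P ⊗[S] Ω[S⁄k]) :=
  haveI : Algebra.IsPushout k S R P := Algebra.IsPushout.symm inferInstance
  prodEquiv k R S P ≪≫ₗ
    LinearEquiv.prodCongr (tensorKaehlerEquiv k S R P).symm (tensorKaehlerEquiv k R S P).symm

/-- Components of the product formula: the base change isomorphisms inverted on the two relative
differentials of `ω`. [cite: Eisenbud1995, Prop. 16.5] -/
theorem tensorProductEquiv_apply (ω : Ω[P⁄k]) :
    tensorProductEquiv k R S P ω =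
      (haveI : Algebra.IsPushout k S R P := Algebra.IsPushout.symm inferInstance; (tensorKaehlerEquiv k S R P).symm (map k S P P ω),
        (tensorKaehlerEquiv k R S P).symm (map k R P P ω)) := rfl

/-- The inverse of the product formula is `(x, y) ↦ (p ⊗ dr ↦ p·dr) x + (p ⊗ ds ↦ p·ds) y`, the sum of
the two base change maps. [cite: Eisenbud1995, Prop. 16.5] -/
@[simp]
theorem tensorProductEquiv_symm_apply (x : P ⊗[R] Ω[R⁄k]) (y : P ⊗[S] Ω[S⁄k]) :
    (tensorProductEquiv k R S P).symm (x, y) = mapBaseChange k R P x + mapBaseChange k S P y := by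
  haveI : Algebra.IsPushout k S R P := Algebra.IsPushout.symm inferInstance
  rw [LinearEquiv.symm_apply_eq, tensorProductEquiv_apply, Prod.mk.injEq]
  refine ⟨?_, ?_⟩
  · rw [LinearEquiv.eq_symm_apply, LinearMap.map_add, map_mapBaseChange_right k S R P x,
      map_mapBaseChange_self, add_zero]
  · rw [LinearEquiv.eq_symm_apply, LinearMap.map_add, map_mapBaseChange_self,
      map_mapBaseChange_right k R S P y, zero_add]

/-- `p ⊗ dr ↦ p · d(r·1)` under the inverse of the product formula. [cite: Eisenbud1995, Prop. 16.5] -/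
theorem tensorProductEquiv_symm_tmul_D_left (p : P) (r : R) :
    (tensorProductEquiv k R S P).symm (p ⊗ₜ D k R r, 0) = p • D k P (algebraMap R P r) := by
  rw [tensorProductEquiv_symm_apply, map_zero, add_zero, mapBaseChange_tmul, map_D]

/-- `p ⊗ ds ↦ p · d(1·s)` under the inverse of the product formula. [cite: Eisenbud1995, Prop. 16.5] -/
theorem tensorProductEquiv_symm_tmul_D_right (p : P) (s : S) :
    (tensorProductEquiv k R S P).symm (0, p ⊗ₜ D k S s) = p • D k P (algebraMap S P s) := by
  rw [tensorProductEquiv_symm_apply, map_zero, zero_add, mapBaseChange_tmul, map_D]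

/-- The product formula on `d(r·1)`: `(1 ⊗ dr, 0)`. [cite: Eisenbud1995, Prop. 16.5] -/
@[simp]
theorem tensorProductEquiv_D_algebraMap_left (r : R) :
    tensorProductEquiv k R S P (D k P (algebraMap R P r)) = (1 ⊗ₜ D k R r, 0) := by
  rw [← LinearEquiv.eq_symm_apply, tensorProductEquiv_symm_tmul_D_left, one_smul]

/-- The product formula on `d(1·s)`: `(0, 1 ⊗ ds)`. [cite: Eisenbud1995, Prop. 16.5] -/
@[simp]
theorem tensorProductEquiv_D_algebraMap_right (s : S) :
    tensorProductEquiv k R S P (D k P (algebraMap S P s)) = (0, 1 ⊗ₜ D k S s) := by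
  rw [← LinearEquiv.eq_symm_apply, tensorProductEquiv_symm_tmul_D_right, one_smul]

/-- The product formula on `d(r·s)` (`r·s = algebraMap R P r * algebraMap S P s`, a pure tensor when
`P = R ⊗[k] S`): `(s ⊗ dr, r ⊗ ds)` (Leibniz). [cite: Eisenbud1995, Prop. 16.5] -/
theorem tensorProductEquiv_D_mul (r : R) (s : S) :
    tensorProductEquiv k R S P (D k P (algebraMap R P r * algebraMap S P s)) =
      (algebraMap S P s ⊗ₜ D k R r, algebraMap R P r ⊗ₜ D k S s) := by
  rw [Derivation.leibniz, map_add, map_smul, map_smul, tensorProductEquiv_D_algebraMap_left,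
    tensorProductEquiv_D_algebraMap_right, Prod.smul_mk, Prod.smul_mk, smul_zero, smul_zero,
    Prod.mk_add_mk, add_zero, zero_add, TensorProduct.smul_tmul', TensorProduct.smul_tmul', smul_eq_mul,
    smul_eq_mul, mul_one, mul_one]

end KaehlerDifferential

end Literature.Algebra.Derivations
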